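import Literature.NumberTheory.EllipticCurves.NewformsPNewProofs
import Literature.NumberTheory.EllipticCurves.NewformsMainLemmaTraceProofs
import HarnessLib

/-!
# Strong multiplicity one across levels on `Γ₀(N)`, proved
# (trunk EllArithM; discharge of `IsNewform0.level_eq_of_heckeEigenvalue_eq` of `Newforms.lean`)

`Newforms.lean` states as a named fact (D-0014)

  `IsNewform0.level_eq_of_heckeEigenvalue_eq : ∀ {N'} {f ∈ S_k(Γ₀(N))} {g ∈ S_k(Γ₀(N'))},
    IsNewform0 f → IsNewform0 g → {p prime | λ_f(p) ≠ λ_g(p)}.Finite → N = N'`,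

**strong multiplicity one across levels**: newforms of levels `Γ₀(N)`, `Γ₀(N')` with the same Hecke
eigenvalues at all but finitely many primes have the same level (Atkin–Lehner, *Hecke operators on
`Γ₀(m)`*, Math. Ann. 185 (1970), Thm. 4; Diamond–Shurman p. 199: "We do not prove Strong
Multiplicity One. See for example [Miy89]"; Miyake, *Modular forms*, Thm. 4.6.19, proves it with the
functional equations of the `L`-functions). This file discharges it:
`theorem IsNewform0.level_eq_of_heckeEigenvalue_eq_holds`.

## The proof (a `p`-primary old/new dichotomy; no `L`-functions)

Let `f`, `g` be newforms of levels `N ≠ N'` with `λ_f(q) = λ_g(q)` for all primes `q` outside a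
finite set `S`. Pick a prime `p` with `v_p(N) ≠ v_p(N')`, say `v_p(N) < v_p(N')` (otherwise swap
`f` and `g`), and the common level `L = N · (N'/gcd(N,N')) · ∏_{q ∈ S, q ∤ NN'} q`
(`exists_level_data`): then `L = p M` with `N ∣ M`, while `N' = p Q` and `L = N' c` with `p ∤ c`,
and every prime of `S` divides `L`.

1. (`NewformsStrongMultiplicityOne`, from the Main Lemma `atkinLehnerMainLemma0_holds` of
   `NewformsMainLemmaTraceProofs`, Atkin–Lehner 1970 Thm. 1, and the spanning half of the
   Atkin–Lehner decomposition) `f - g ∈ ∑_{(M₀,d), M₀ d ∣ L, d ≠ 1} [diag(d,1)]_k S_k(Γ₀(M₀))^{new}`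
   (`IsNewform0.sub_mem_biSup_atkinLehnerComponent`).
2. (`NewformsPNewProofs`) Each component `[diag(d,1)]_k S_k(Γ₀(M₀))^{new}` of `S_k(Γ₀(L))` is either
   **`p`-old** — in `S_k(Γ₀(M)) + [diag(p,1)]_k S_k(Γ₀(M))`, when `p ∣ d` or `M₀ d ∣ M` — or
   **`p`-new** — killed by the two adjoint degeneracy maps to level `M`, when `v_p(M₀) = v_p(L)`
   (`atkinLehnerComponent_le_pOld_or_le_pNew`); `f` (level `N ∣ M`) is `p`-old and `g`
   (`v_p(N') = v_p(L)`, `g` new) is `p`-new.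
3. So `f - g = y + z` with `y` `p`-old and `z` `p`-new with `a₁(z) = 0` (components with `d ≠ 1`
   have vanishing first coefficient), whence `g + z = f - y` is both `p`-old and `p`-new, hence `0`
   by `disjoint_pOld_pNew` (Petersson adjointness and definiteness) — but `a₁(g + z) = a₁(g) = 1`.

Unitarity (the Petersson product) enters only through `disjoint_pOld_pNew` and the old/new
decomposition behind step 1; the rest is double-coset algebra. With the Main Lemma and the
directness of the Atkin–Lehner decomposition the tree also has the reduction
`IsNewform0.level_eq_of_heckeEigenvalue_eq_of_atkinLehnerMainLemma0` (`NewformsStrongMultiplicityOne`);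
the present proof does not need directness (which is in fact equivalent to the theorem).

## Main results (namespace `Literature.NumberTheory.EllipticCurves.ModularForms`)

* `atkinLehnerComponent_le_pOld_or_le_pNew`: the dichotomy of step 2.
* `exists_level_data`: the auxiliary level.
* `IsNewform0.level_ne_aux`: steps 1–3 for a given `p`, `L`.
* `IsNewform0.level_eq_of_heckeEigenvalue_eq_holds : IsNewform0.level_eq_of_heckeEigenvalue_eq` — for
  every level `N ≥ 1` and weight `k : ℤ` (implicit, as in the fact).

## References

* A. O. L. Atkin, J. Lehner, *Hecke operators on `Γ₀(m)`*, Math. Ann. 185 (1970), 134–160, Thm. 4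
  (with Thm. 1; not held, acquisition request acq-00354). doi:10.1007/BF01359701
* F. Diamond, J. Shurman, *A first course in modular forms*, GTM 228, Springer 2005, §5.6–§5.8
  (Def. 5.6.1, Thm. 5.7.1, p. 199) (lit store `book:diamond2005-first-course-modular-forms`).
* T. Miyake, *Modular forms*, Springer 1989, Thm. 4.6.19.
-/

noncomputable section

open scoped MatrixGroups ModularForm

open CongruenceSubgroup UpperHalfPlane

namespace Literature.NumberTheory.EllipticCurves.ModularForms

/-! ### The `p`-primary dichotomy of the Atkin–Lehner components -/

section Dichotomy

variable {p : ℕ} [NeZero p] {k : ℤ} {L M : ℕ} [NeZero L] [NeZero M]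

omit [NeZero M] in
/-- The components `[diag(d,1)]_k S_k(Γ₀(M₀))^{new}` with `d ≠ 1` have vanishing first Fourier
coefficient: `a₁([diag(d,1)]_k n) = d^{k-1} a_{1/d}(n) = 0` (`qExpansion_coeff_iota`;
Diamond–Shurman §5.7, `ι_d` on Fourier expansions). [cite: DiamondShurman2005, §5.7 (ι_d on Fourier expansions)] -/
theorem qExpansion_coeff_one_eq_zero_of_mem_atkinLehnerComponent {x : AtkinLehnerIndex L}
    (hx : x.1.2 ≠ 1) {u : CuspForm (Gamma0 L) k} (hu : u ∈ atkinLehnerComponent L k x) :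
    (qExpansion 1 ⇑u).coeff 1 = 0 := by
  obtain ⟨n, -, rfl⟩ := hu
  rw [degeneracyMap0_eq_smul_iota x.1.1 L x.1.2 k x.2, qExpansion_coeff_smul,
    qExpansion_coeff_iota, if_neg (fun h ↦ hx (Nat.dvd_one.mp h)), mul_zero]

/-- **The `p`-primary dichotomy of the Atkin–Lehner components.** For a prime `p`, `L = p M` and an
index `(M₀, d)`, `M₀ d c = L`: the component `[diag(d,1)]_k S_k(Γ₀(M₀))^{new}` of `S_k(Γ₀(L))` is
`p`-old (if `p ∣ d`, or if `p ∣ c`, i.e. `M₀ d ∣ M`; `map_degeneracyMap0_le_pOld_of_mul/dvd`) or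
`p`-new (if `p ∤ d c`, so that `p ∣ M₀` has full valuation; `map_degeneracyMap0_newSubspace0_le_pNew`). [folklore] -/
theorem atkinLehnerComponent_le_pOld_or_le_pNew (hp : p.Prime) (hL : L = p * M)
    (x : AtkinLehnerIndex L) :
    atkinLehnerComponent L k x ≤
        LinearMap.range (degeneracyMap0 M L 1 k) ⊔ LinearMap.range (degeneracyMap0 M L p k) ∨
      atkinLehnerComponent L k x ≤
        LinearMap.ker (adjDegeneracyMap0 L M 1 k) ⊓ LinearMap.ker (adjDegeneracyMap0 L M p k) := by
  obtain ⟨⟨M₀, d⟩, hMd⟩ := x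
  obtain ⟨c, hc⟩ := hMd
  haveI : NeZero M₀ := ⟨fun h ↦ NeZero.ne L (by rw [hc, h]; ring)⟩
  haveI : NeZero d := ⟨fun h ↦ NeZero.ne L (by rw [hc, h]; ring)⟩
  haveI : NeZero c := ⟨fun h ↦ NeZero.ne L (by rw [hc, h]; ring)⟩
  unfold atkinLehnerComponent
  simp only
  by_cases hpd : p ∣ d
  · -- `p ∣ d`: the component is in the range of `[diag(p,1)]_k` from level `M`
    left
    obtain ⟨d₀, hd₀⟩ := hpd
    obtain rfl : d = d₀ * p := by rw [hd₀, mul_comm]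
    haveI : NeZero d₀ := ⟨fun h ↦ NeZero.ne (d₀ * p) (by rw [h]; ring)⟩
    have hM : M = M₀ * d₀ * c := by
      apply Nat.eq_of_mul_eq_mul_left hp.pos
      rw [← hL, hc]; ring
    exact map_degeneracyMap0_le_pOld_of_mul (N := L) ⟨c, hM⟩ ⟨1, by rw [hL]; ring⟩ _
  · by_cases hpc : p ∣ c
    · -- `p ∣ L/(M₀ d)`: `M₀ d ∣ M`, the component comes from level `M` by inclusion
      left
      obtain ⟨c₀, rfl⟩ := hpc
      have hM : M = M₀ * d * c₀ := by
        apply Nat.eq_of_mul_eq_mul_left hp.pos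
        rw [← hL, hc]; ring
      exact map_degeneracyMap0_le_pOld_of_dvd (N := L) (p := p) ⟨c₀, hM⟩ ⟨p, by rw [hL]; ring⟩ _
    · -- `p ∤ d`, `p ∤ c`: `p ∣ M₀` with full valuation, the component is `p`-new
      right
      have hpM₀ : p ∣ M₀ := by
        have : p ∣ M₀ * d * c := ⟨M, by rw [← hc, hL]⟩
        rcases (Nat.Prime.dvd_mul hp).mp this with h | h
        · exact ((Nat.Prime.dvd_mul hp).mp h).elim id (fun h ↦ absurd h hpd)
        · exact absurd h hpc
      obtain ⟨Q, hQ⟩ := hpM₀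
      haveI : NeZero Q := ⟨fun h ↦ NeZero.ne M₀ (by rw [hQ, h]; ring)⟩
      exact map_degeneracyMap0_newSubspace0_le_pNew hp hL hQ hc.symm hpd hpc

/-- Step 3, bookkeeping: every element of `∑_{d ≠ 1} [diag(d,1)]_k S_k(Γ₀(M₀))^{new}` is `y + z`
with `y` `p`-old and `z` `p`-new with `a₁(z) = 0` (induction over the sum, using the dichotomy
`atkinLehnerComponent_le_pOld_or_le_pNew` and
`qExpansion_coeff_one_eq_zero_of_mem_atkinLehnerComponent`). [folklore] -/
theorem exists_pOld_add_pNew_of_mem_biSup (hp : p.Prime) (hL : L = p * M)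
    {u : CuspForm (Gamma0 L) k}
    (hu : u ∈ ⨆ x ∈ {x : AtkinLehnerIndex L | x.1.2 ≠ 1}, atkinLehnerComponent L k x) :
    ∃ y ∈ LinearMap.range (degeneracyMap0 M L 1 k) ⊔ LinearMap.range (degeneracyMap0 M L p k),
      ∃ z ∈ LinearMap.ker (adjDegeneracyMap0 L M 1 k) ⊓ LinearMap.ker (adjDegeneracyMap0 L M p k),
        (qExpansion 1 ⇑z).coeff 1 = 0 ∧ u = y + z := by
  rw [iSup_subtype'] at hu
  have a0 : (qExpansion 1 ⇑(0 : CuspForm (Gamma0 L) k)).coeff 1 = 0 := by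
    rw [show (⇑(0 : CuspForm (Gamma0 L) k) : ℍ → ℂ) = 0 from rfl, UpperHalfPlane.qExpansion_zero]
    simp
  refine Submodule.iSup_induction _
    (motive := fun u ↦ ∃ y ∈ LinearMap.range (degeneracyMap0 M L 1 k) ⊔
        LinearMap.range (degeneracyMap0 M L p k),
      ∃ z ∈ LinearMap.ker (adjDegeneracyMap0 L M 1 k) ⊓ LinearMap.ker (adjDegeneracyMap0 L M p k),
        (qExpansion 1 ⇑z).coeff 1 = 0 ∧ u = y + z) hu ?_ ?_ ?_
  · rintro ⟨x, hx⟩ u hux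
    rcases atkinLehnerComponent_le_pOld_or_le_pNew (k := k) hp hL x with h | h
    · exact ⟨u, h hux, 0, zero_mem _, a0, (add_zero u).symm⟩
    · exact ⟨0, zero_mem _, u, h hux,
        qExpansion_coeff_one_eq_zero_of_mem_atkinLehnerComponent hx hux, (zero_add u).symm⟩
  · exact ⟨0, zero_mem _, 0, zero_mem _, a0, (add_zero 0).symm⟩
  · rintro u v ⟨y, hy, z, hz, hz1, rfl⟩ ⟨y', hy', z', hz', hz'1, rfl⟩
    refine ⟨y + y', add_mem hy hy', z + z', add_mem hz hz', ?_, by abel⟩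
    rw [qExpansion_coeff_add_level0, hz1, hz'1, add_zero]

end Dichotomy

/-! ### The auxiliary level -/

section LevelData

/-- **Choice of the auxiliary level.** Given levels `N, N' ≥ 1`, a prime `p` dividing
`N' / gcd(N, N')` (i.e. `v_p(N) < v_p(N')`) and a finite set `S` of primes, there is a common
multiple `L = p M` of `N`, `N'` and of every prime in `S` with `N ∣ M` (so `v_p(N) < v_p(L)`),
`N' = p Q` and `N' c = L` with `p ∤ c` (so `v_p(N') = v_p(L)`): namely
`L = N · (N'/gcd(N,N')) · ∏_{q ∈ S, q ∤ N N'} q`. [folklore] -/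
theorem exists_level_data {N N' p : ℕ} (hN : N ≠ 0) (hN' : N' ≠ 0) (hp : p.Prime)
    (hpb : p ∣ N' / Nat.gcd N N') (S : Finset ℕ) (hS : ∀ q ∈ S, q.Prime) :
    ∃ L M Q c : ℕ, L ≠ 0 ∧ M ≠ 0 ∧ Q ≠ 0 ∧ c ≠ 0 ∧ L = p * M ∧ N ∣ M ∧ N' = p * Q ∧
      N' * c = L ∧ ¬ p ∣ c ∧ ∀ q ∈ S, q ∣ L := by
  set g₀ := Nat.gcd N N' with hg₀
  set a := N / g₀ with ha
  set b := N' / g₀ with hb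
  have hg₀pos : 0 < g₀ := Nat.gcd_pos_of_pos_left _ (Nat.pos_of_ne_zero hN)
  have hNa : N = g₀ * a := by rw [ha, Nat.mul_div_cancel' (Nat.gcd_dvd_left N N')]
  have hN'b : N' = g₀ * b := by rw [hb, Nat.mul_div_cancel' (Nat.gcd_dvd_right N N')]
  have hab : Nat.Coprime a b := Nat.coprime_div_gcd_div_gcd hg₀pos
  have ha0 : a ≠ 0 := fun h ↦ hN (by rw [hNa, h, mul_zero])
  have hb0 : b ≠ 0 := fun h ↦ hN' (by rw [hN'b, h, mul_zero])
  obtain ⟨b₀, hb₀⟩ := hpb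
  have hb₀0 : b₀ ≠ 0 := fun h ↦ hb0 (by rw [hb₀, h, mul_zero])
  -- the primes of `S` not dividing `N N'`
  set P : ℕ := ∏ q ∈ S.filter (fun q ↦ ¬ q ∣ N * N'), q with hP
  have hP0 : P ≠ 0 :=
    Finset.prod_ne_zero_iff.mpr fun q hq ↦ (hS q (Finset.mem_filter.mp hq).1).ne_zero
  have hpa : ¬ p ∣ a := fun h ↦ by
    have : p ∣ Nat.gcd a b := Nat.dvd_gcd h ⟨b₀, hb₀⟩
    rw [hab.gcd_eq_one] at this
    exact hp.one_lt.ne' (Nat.dvd_one.mp this)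
  have hpN' : p ∣ N' := ⟨g₀ * b₀, by rw [hN'b, hb₀]; ring⟩
  have hpP : ¬ p ∣ P := fun h ↦ by
    obtain ⟨q, hq, hpq⟩ := (Prime.dvd_finsetProd_iff hp.prime _).mp h
    obtain ⟨hqS, hqN⟩ := Finset.mem_filter.mp hq
    have hpq' : p = q := (Nat.prime_dvd_prime_iff_eq hp (hS q hqS)).mp hpq
    exact hqN (hpq' ▸ hpN'.mul_left N)
  refine ⟨N * b * P, N * b₀ * P, g₀ * b₀, a * P, mul_ne_zero (mul_ne_zero hN hb0) hP0,
    mul_ne_zero (mul_ne_zero hN hb₀0) hP0, mul_ne_zero hg₀pos.ne' hb₀0, mul_ne_zero ha0 hP0,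
    by rw [hb₀]; ring, ⟨b₀ * P, by ring⟩, by rw [hN'b, hb₀]; ring, by rw [hN'b, hNa]; ring,
    fun h ↦ ((Nat.Prime.dvd_mul hp).mp h).elim hpa hpP, fun q hq ↦ ?_⟩
  by_cases hqN : q ∣ N * N'
  · rcases (Nat.Prime.dvd_mul (hS q hq)).mp hqN with h | h
    · exact (h.mul_right b).mul_right P
    · exact h.trans ⟨a * P, by rw [hN'b, hNa]; ring⟩
  · exact (Finset.dvd_prod_of_mem (fun q : ℕ ↦ q) (Finset.mem_filter.mpr ⟨hq, hqN⟩)).mul_left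
      (N * b)

end LevelData

/-! ### Assembly -/

section Assembly

variable {N : ℕ} [NeZero N] {k : ℤ}

/-- **Core of the proof of Atkin–Lehner's Theorem 4 across levels** (steps 1–3 of the module
docstring): newforms `f ∈ S_k(Γ₀(N))`, `g ∈ S_k(Γ₀(N'))` with the same eigenvalues at the primes
`q ∤ L`, where `L = p M`, `N ∣ M`, `N' = p Q`, `N' c = L`, `p ∤ c`, cannot exist: `f - g` lies in
the components with `d ≠ 1` (Main Lemma), which are `p`-old plus `p`-new with `a₁ = 0`, while `f`
is `p`-old and `g` is `p`-new; `p`-old `∩` `p`-new `= 0` then forces `a₁(g) = 0 ≠ 1`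
(Atkin–Lehner 1970, Thm. 4). [cite: AtkinLehner1970, Thm. 4] -/
theorem IsNewform0.level_ne_aux {N' : ℕ} [NeZero N'] {f : CuspForm (Gamma0 N) k}
    {g : CuspForm (Gamma0 N') k} (hf : IsNewform0 f) (hg : IsNewform0 g) {p L M Q c : ℕ}
    (hp : p.Prime) (hL0 : L ≠ 0) (hM0 : M ≠ 0) (hQ0 : Q ≠ 0) (hc0 : c ≠ 0) (hL : L = p * M)
    (hNM : N ∣ M) (hN' : N' = p * Q) (hc : N' * c = L) (hpc : ¬ p ∣ c)
    (h : ∀ q : ℕ, q.Prime → ¬ q ∣ L → heckeEigenvalue f q = heckeEigenvalue g q) : False := by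
  haveI : NeZero L := ⟨hL0⟩
  haveI : NeZero M := ⟨hM0⟩
  haveI : NeZero Q := ⟨hQ0⟩
  haveI : NeZero c := ⟨hc0⟩
  haveI : NeZero p := ⟨hp.ne_zero⟩
  have hML : M ∣ L := ⟨p, by rw [hL]; ring⟩
  have hNL : N ∣ L := hNM.trans hML
  have hN'L : N' ∣ L := ⟨c, hc.symm⟩
  -- step 1: `f - g` lies in the components with `d ≠ 1` (Main Lemma)
  have hF := hf.sub_mem_biSup_atkinLehnerComponent hg hNL hN'L h (atkinLehnerMainLemma0_holds k L)
  -- steps 2–3: `f - g = y + z`, `y` `p`-old, `z` `p`-new with `a₁(z) = 0`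
  obtain ⟨y, hy, z, hz, hz1, hyz⟩ := exists_pOld_add_pNew_of_mem_biSup hp hL hF
  -- `f` is `p`-old, `g` is `p`-new at level `L`
  have hfO : degeneracyMap0 N L 1 k f ∈
      LinearMap.range (degeneracyMap0 M L 1 k) ⊔ LinearMap.range (degeneracyMap0 M L p k) :=
    map_degeneracyMap0_le_pOld_of_dvd (N := L) (p := p) (by simpa using hNM) hML ⊤
      ⟨f, trivial, rfl⟩
  have hgN : degeneracyMap0 N' L 1 k g ∈
      LinearMap.ker (adjDegeneracyMap0 L M 1 k) ⊓ LinearMap.ker (adjDegeneracyMap0 L M p k) :=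
    degeneracyMap0_mem_pNew hp hL hN' (by simpa using hc) (Nat.Prime.not_dvd_one hp) hpc hg.1
  -- hence `g + z = f - y` is both, so it vanishes
  have key : degeneracyMap0 N' L 1 k g + z = 0 := by
    refine Submodule.disjoint_def.mp (disjoint_pOld_pNew hL) _ ?_ (add_mem hgN hz)
    have hfg : degeneracyMap0 N L 1 k f = y + z + degeneracyMap0 N' L 1 k g :=
      sub_eq_iff_eq_add.mp hyz
    have : degeneracyMap0 N' L 1 k g + z = degeneracyMap0 N L 1 k f - y := by rw [hfg]; abel
    rw [this]
    exact sub_mem hfO hy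
  -- first coefficients: `1 = a₁(g) = a₁(g + z) = 0`
  have h1 := congrArg (fun u : CuspForm (Gamma0 L) k ↦ (qExpansion 1 ⇑u).coeff 1) key
  rw [qExpansion_coeff_add_level0, hz1, add_zero, qExpansion_degeneracyMap0_one N' L k hN'L g,
    show (qExpansion 1 ⇑g).coeff 1 = 1 from hg.2.2,
    show (⇑(0 : CuspForm (Gamma0 L) k) : ℍ → ℂ) = 0 from rfl, UpperHalfPlane.qExpansion_zero] at h1
  simp at h1

/-- **Strong multiplicity one across levels on `Γ₀(N)` (Atkin–Lehner 1970, Thm. 4), proved**: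
discharge of the named fact `IsNewform0.level_eq_of_heckeEigenvalue_eq` of `Newforms.lean` —
newforms `f ∈ S_k(Γ₀(N))`, `g ∈ S_k(Γ₀(N'))` with the same Hecke eigenvalues at all but finitely
many primes have `N = N'` (and then `f = g`, `IsNewform0.eq_of_heckeEigenvalue_eq_holds`). If
`N ≠ N'`, some prime `p` has `v_p(N) ≠ v_p(N')`; with the auxiliary level of `exists_level_data`
the impossibility is `IsNewform0.level_ne_aux` (applied to `(f, g)` or to `(g, f)`). Diamond–Shurman
(p. 199) leave this unproved ("see [Miy89]"); the present proof replaces Miyake's `L`-function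
argument (Thm. 4.6.19) by the `p`-primary old/new dichotomy of `NewformsPNewProofs`. [cite: AtkinLehner1970, Thm. 4] -/
theorem IsNewform0.level_eq_of_heckeEigenvalue_eq_holds :
    IsNewform0.level_eq_of_heckeEigenvalue_eq (N := N) (k := k) := by
  intro N' _ f g hf hg hfin
  by_contra hNN'
  set S := hfin.toFinset with hS_def
  have hS : ∀ q ∈ S, q.Prime := fun q hq ↦ (hfin.mem_toFinset.mp hq).1
  have hSf : ∀ L : ℕ, (∀ q ∈ S, q ∣ L) →
      ∀ q : ℕ, q.Prime → ¬ q ∣ L → heckeEigenvalue f q = heckeEigenvalue g q :=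
    fun L hL q hq hqL ↦ by_contra fun hne ↦ hqL (hL q (hfin.mem_toFinset.mpr ⟨hq, hne⟩))
  have hN0 : N ≠ 0 := NeZero.ne N
  have hN'0 : N' ≠ 0 := NeZero.ne N'
  -- a prime at which the valuations of `N` and `N'` differ
  set g₀ := Nat.gcd N N' with hg₀
  have hab : ¬ (N / g₀ = 1 ∧ N' / g₀ = 1) := by
    rintro ⟨ha, hb⟩
    apply hNN'
    calc N = N / g₀ * g₀ := (Nat.div_mul_cancel (Nat.gcd_dvd_left N N')).symm
      _ = N' / g₀ * g₀ := by rw [ha, hb]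
      _ = N' := Nat.div_mul_cancel (Nat.gcd_dvd_right N N')
  rcases not_and_or.mp hab with ha | hb
  · -- `v_p(N) > v_p(N')` at `p = minFac (N/gcd)`: swap the roles of `f` and `g`
    have hp : (N / g₀).minFac.Prime := Nat.minFac_prime ha
    obtain ⟨L, M, Q, c, hL0, hM0, hQ0, hc0, hL, hNM, hN', hc, hpc, hSL⟩ :=
      exists_level_data hN'0 hN0 hp (by rw [Nat.gcd_comm]; exact Nat.minFac_dvd _) S hS
    exact hg.level_ne_aux hf hp hL0 hM0 hQ0 hc0 hL hNM hN' hc hpc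
      (fun q hq hqL ↦ (hSf L hSL q hq hqL).symm)
  · have hp : (N' / g₀).minFac.Prime := Nat.minFac_prime hb
    obtain ⟨L, M, Q, c, hL0, hM0, hQ0, hc0, hL, hNM, hN', hc, hpc, hSL⟩ :=
      exists_level_data hN0 hN'0 hp (Nat.minFac_dvd _) S hS
    exact hf.level_ne_aux hg hp hL0 hM0 hQ0 hc0 hL hNM hN' hc hpc (hSf L hSL)

end Assembly

end Literature.NumberTheory.EllipticCurves.ModularForms
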